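import Mathlib
import HarnessLib
import Summits.Ventures.LatticeQCDFlow.Scoring.RestartChainPairedProtocolAgreement
import Summits.Ventures.LatticeQCDFlow.Scoring.CPNRestartChainJarzynski

/-!
# S0-D2 AS RUN — the PAIRED protocol-comparison test of NE-MCMC on one `cpn_2d` stream (the
# Metropolis sweep as the prior): asymptotically standard normal and calibrated with NO hypothesis on
# the prior side

HONEST FRAMING: exact (Metropolis-corrected) sampling algorithms for lattice gauge theory;
figures of merit are autocorrelation/cost numbers at stated couplings and volumes; no
continuum-physics claim.

Venture `LatticeQCDFlow` (cell pub-lqcd), topic `Scoring`; FANOUT row 8 (`s0-cpn-nemc`, GEN-25).  NEW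
WORK of the cell, not a published result; no definition is introduced; nothing is cited as a fact.
Instances of `Scoring/RestartChainPairedProtocolAgreement.lean` (271) with the prior-side hypotheses
DISCHARGED by
`Scoring/CPNRestartChainJarzynski.cpn_metropolisSweep_minorised_by_cpnGibbsLaw` (269): the `cpn_2d`
Metropolis sweep (`εs, εl > 0`, scan visiting every variable) leaves `cpnGibbsLaw src tgt J c`
invariant and is minorised in one step by it.  For ANY Crooks pairs `(κF, κR, s, e, W)` on `R` and
`(κF', κR', s', e', W')` on `R'` from a finite `ν₀` with `Z₀⁻¹ ν₀ = cpnGibbsLaw` to a finite `ν₁`,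
work floors and positive asymptotic variances (ASSUMED):

* **`cpn_restart_pairedProtocol_agreement_clt`** / **`_coverage`** — both protocols launched from the
  SAME `cpn_2d` stream: the studentised mean of the weight differences with the batch-means bar of
  the differences ⇒ `N(0, 1)`, calibrated.

NOT CLAIMED: the construction of the CP(N−1) non-equilibrium evolutions as Crooks pairs
(hypotheses); the OR:HB prior (same one-line argument with
`Scoring/CPNHeatBathRestartChainJarzynski.lean`); the two-protocol test with independent `cpn_2d`
runs (`Scoring/CPNRestartTwoProtocolAgreement.lean`); any value of the variances; any number of ours.
-/

noncomputable section

namespace Summit.Ventures.LatticeQCDFlow.Scoring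

open MeasureTheory ProbabilityTheory Filter Finset Preorder Set
open Summit.Ventures.LatticeQCDFlow.Exactness Summit.Ventures.LatticeQCDFlow.Exactness.GeneralNCMC
open Literature.Probability.MarkovChains
open scoped ENNReal Topology

section CPN

variable {V E : Type*} [Fintype V] [Fintype E] [DecidableEq V] [DecidableEq E] {d : ℕ}
  (src tgt : E → V) (J : EuclideanSpace ℝ (Fin (d + 2)) →L[ℝ] EuclideanSpace ℝ (Fin (d + 2)))
  (c : E → ℝ)

variable {R R' : Type*} [MeasurableSpace R] [MeasurableSpace R']
  {ν₀ ν₁ : Measure (CPNConfig V E d)}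
  {κF κR : Kernel (CPNConfig V E d) R} [IsMarkovKernel κF] [IsMarkovKernel κR]
  {s e : R → CPNConfig V E d} {W : R → ℝ}
  {κF' κR' : Kernel (CPNConfig V E d) R'} [IsMarkovKernel κF'] [IsMarkovKernel κR']
  {s' e' : R' → CPNConfig V E d} {W' : R' → ℝ}

/-- **THE PAIRED TEST ON ONE `cpn_2d` STREAM, FROM EVERY START.** -/
theorem cpn_restart_pairedProtocol_agreement_clt
    {εs εl : ℝ} (hεs : 0 < εs) (hεl : 0 < εl) {l : List (V ⊕ E)} (hl : ∀ i, i ∈ l)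
    (h : CrooksPair ν₀ ν₁ κF κR s e W) (h' : CrooksPair ν₀ ν₁ κF' κR' s' e' W')
    (hπ₀ : cpnGibbsLaw src tgt J c = (ν₀ univ)⁻¹ • ν₀)
    {Wlo : ℝ} (hlo : ∀ ω, Wlo ≤ W ω) {Wlo' : ℝ} (hlo' : ∀ ω, Wlo' ≤ W' ω)
    (hσ : 0 < ((∫ p, (Real.exp (-W p.2.1) - Real.exp (-W' p.2.2)) ^ 2 ∂(cpnGibbsLaw src tgt J c ⊗ₘ (κF ×ₖ κF')))
          + 2 * ∑' k, ∫ p, (Real.exp (-W p.2.1) - Real.exp (-W' p.2.2))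
            * (kop ((Kernel.prodMkRight (R × R')
              (cpnMetropolisSweep src tgt J c εs εl l))
                ⊗ₖ (Kernel.prodMkLeft (CPNConfig V E d × (R × R')) (κF ×ₖ κF'))))^[k + 1]
              (fun p => Real.exp (-W p.2.1) - Real.exp (-W' p.2.2)) p ∂(cpnGibbsLaw src tgt J c ⊗ₘ (κF ×ₖ κF'))))
    [hK : IsMarkovKernel (cpnMetropolisSweep src tgt J c εs εl l)]
    (μ₀ : Measure (CPNConfig V E d × (R × R'))) [IsProbabilityMeasure μ₀] {a b : ℕ → ℕ}
    (ha : Tendsto a atTop atTop) (hb : Tendsto b atTop atTop)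
    {Ω' : Type*} [MeasurableSpace Ω'] {P' : Measure Ω'} [IsProbabilityMeasure P'] {Y : Ω' → ℝ}
    (hY : HasLaw Y (gaussianReal 0 1) P')
    [IsProbabilityMeasure (Kernel.trajMeasure (X := fun _ : ℕ => CPNConfig V E d × (R × R')) μ₀
          (fun n : ℕ => ((Kernel.prodMkRight (R × R')
              (cpnMetropolisSweep src tgt J c εs εl l))
              ⊗ₖ (Kernel.prodMkLeft (CPNConfig V E d × (R × R')) (κF ×ₖ κF'))).comap
            (fun h : (i : ↥(Finset.Iic n)) → CPNConfig V E d × (R × R') => h ⟨n, Finset.mem_Iic.2 le_rfl⟩)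
            (measurable_pi_apply _)))] :
    TendstoInDistribution (fun (n : ℕ) (x : ℕ → CPNConfig V E d × (R × R')) =>
        ((Real.sqrt ((b n * a n : ℕ) : ℝ))⁻¹
          * ∑ t ∈ Finset.range (b n * a n),
              (Real.exp (-W (x t).2.1) - Real.exp (-W' (x t).2.2)))
        / Real.sqrt (((b n * a n : ℕ) : ℝ)
          * replicaSEsq (fun j (x : ℕ → CPNConfig V E d × (R × R')) =>
              (∑ i ∈ Finset.range (b n),
                (Real.exp (-W (x (b n * j + i)).2.1) - Real.exp (-W' (x (b n * j + i)).2.2)))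
              / (b n)) (a n) x))
      atTop Y (fun _ => (Kernel.trajMeasure (X := fun _ : ℕ => CPNConfig V E d × (R × R')) μ₀
          (fun n : ℕ => ((Kernel.prodMkRight (R × R')
              (cpnMetropolisSweep src tgt J c εs εl l))
              ⊗ₖ (Kernel.prodMkLeft (CPNConfig V E d × (R × R')) (κF ×ₖ κF'))).comap
            (fun h : (i : ↥(Finset.Iic n)) → CPNConfig V E d × (R × R') => h ⟨n, Finset.mem_Iic.2 le_rfl⟩)
            (measurable_pi_apply _)))) P' := by
  haveI := isProbabilityMeasure_cpnGibbsLaw src tgt J c (V := V) (E := E) (d := d)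
  obtain ⟨hinv, ε, hε0, -, hdoeb⟩ :=
    cpn_metropolisSweep_minorised_by_cpnGibbsLaw src tgt J c hεs hεl hl
  exact restart_jarzynski_pairedProtocol_agreement_clt (π₀ := cpnGibbsLaw src tgt J c)
    (κ₀ := cpnMetropolisSweep src tgt J c εs εl l) h h' hπ₀ hinv (fun x _ hB => hdoeb x hB) hε0
    hlo hlo' hσ μ₀ ha hb hY

/-- **… AND IT IS CALIBRATED.** -/
theorem cpn_restart_pairedProtocol_agreement_coverage
    {εs εl : ℝ} (hεs : 0 < εs) (hεl : 0 < εl) {l : List (V ⊕ E)} (hl : ∀ i, i ∈ l)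
    (h : CrooksPair ν₀ ν₁ κF κR s e W) (h' : CrooksPair ν₀ ν₁ κF' κR' s' e' W')
    (hπ₀ : cpnGibbsLaw src tgt J c = (ν₀ univ)⁻¹ • ν₀)
    {Wlo : ℝ} (hlo : ∀ ω, Wlo ≤ W ω) {Wlo' : ℝ} (hlo' : ∀ ω, Wlo' ≤ W' ω)
    (hσ : 0 < ((∫ p, (Real.exp (-W p.2.1) - Real.exp (-W' p.2.2)) ^ 2 ∂(cpnGibbsLaw src tgt J c ⊗ₘ (κF ×ₖ κF')))
          + 2 * ∑' k, ∫ p, (Real.exp (-W p.2.1) - Real.exp (-W' p.2.2))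
            * (kop ((Kernel.prodMkRight (R × R')
              (cpnMetropolisSweep src tgt J c εs εl l))
                ⊗ₖ (Kernel.prodMkLeft (CPNConfig V E d × (R × R')) (κF ×ₖ κF'))))^[k + 1]
              (fun p => Real.exp (-W p.2.1) - Real.exp (-W' p.2.2)) p ∂(cpnGibbsLaw src tgt J c ⊗ₘ (κF ×ₖ κF'))))
    [hK : IsMarkovKernel (cpnMetropolisSweep src tgt J c εs εl l)]
    (μ₀ : Measure (CPNConfig V E d × (R × R'))) [IsProbabilityMeasure μ₀] {a b : ℕ → ℕ}
    (ha : Tendsto a atTop atTop) (hb : Tendsto b atTop atTop) {z : ℝ} (hz : 0 < z)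
    [IsProbabilityMeasure (Kernel.trajMeasure (X := fun _ : ℕ => CPNConfig V E d × (R × R')) μ₀
          (fun n : ℕ => ((Kernel.prodMkRight (R × R')
              (cpnMetropolisSweep src tgt J c εs εl l))
              ⊗ₖ (Kernel.prodMkLeft (CPNConfig V E d × (R × R')) (κF ×ₖ κF'))).comap
            (fun h : (i : ↥(Finset.Iic n)) → CPNConfig V E d × (R × R') => h ⟨n, Finset.mem_Iic.2 le_rfl⟩)
            (measurable_pi_apply _)))] :
    Tendsto (fun n : ℕ => (Kernel.trajMeasure (X := fun _ : ℕ => CPNConfig V E d × (R × R')) μ₀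
          (fun n : ℕ => ((Kernel.prodMkRight (R × R')
              (cpnMetropolisSweep src tgt J c εs εl l))
              ⊗ₖ (Kernel.prodMkLeft (CPNConfig V E d × (R × R')) (κF ×ₖ κF'))).comap
            (fun h : (i : ↥(Finset.Iic n)) → CPNConfig V E d × (R × R') => h ⟨n, Finset.mem_Iic.2 le_rfl⟩)
            (measurable_pi_apply _))).real
      {x | |((Real.sqrt ((b n * a n : ℕ) : ℝ))⁻¹
          * ∑ t ∈ Finset.range (b n * a n),
              (Real.exp (-W (x t).2.1) - Real.exp (-W' (x t).2.2)))
        / Real.sqrt (((b n * a n : ℕ) : ℝ)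
          * replicaSEsq (fun j (x : ℕ → CPNConfig V E d × (R × R')) =>
              (∑ i ∈ Finset.range (b n),
                (Real.exp (-W (x (b n * j + i)).2.1) - Real.exp (-W' (x (b n * j + i)).2.2)))
              / (b n)) (a n) x)| ≤ z})
      atTop (𝓝 ((gaussianReal 0 1).real (Set.Icc (-z) z))) := by
  haveI := isProbabilityMeasure_cpnGibbsLaw src tgt J c (V := V) (E := E) (d := d)
  obtain ⟨hinv, ε, hε0, -, hdoeb⟩ :=
    cpn_metropolisSweep_minorised_by_cpnGibbsLaw src tgt J c hεs hεl hl
  exact restart_jarzynski_pairedProtocol_agreement_coverage (π₀ := cpnGibbsLaw src tgt J c)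
    (κ₀ := cpnMetropolisSweep src tgt J c εs εl l) h h' hπ₀ hinv (fun x _ hB => hdoeb x hB) hε0
    hlo hlo' hσ μ₀ ha hb hz

end CPN

end Summit.Ventures.LatticeQCDFlow.Scoring

end
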